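import Summits.AtomisticToContinuum.FouriersLaw.Theorems.LatticeLandauDampingAbelThermodynamicLimitFixedFrequencyMatchingUniformLeaves
import HarnessLib

/-!
# `stub_fixedTimeMatching` of line `series-law-at-every-laplace-frequency`, part 2:
`H_time` BY NAME from the two registered anchor-uniform dynamical leaves
(crux `LatticeLandauDamping.AbelThermodynamicLimit`, item stmt-AtomisticToContinuum-14013, `Iff.rfl`-identical
to `EmbeddedDrudeMourre.AbelThermodynamicLimit`, stmt-AtomisticToContinuum-12596; `--supports` helper file
proving the registered reduction stub `stub_fixedTimeMatchingOfRegisteredLeaves`, closes nothing)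

The registered stub `stub_fixedTimeMatching` (`H_time`): for the OPEN pinned anharmonic chain
`P = pinnedChain ω₂ lam β γ` (all `> 0`, both Langevin baths at `T > 0`), `T` with DLR uniqueness in the
regular class, and a regular witness `(μT, D)` (DLR, shift-invariant, BM-superstable state; `D.carrier ⊆ bmGood`,
`μT`-preserving, absolutely convergent correlations), the per-length equilibrium autocorrelation of the
total bond current converges at a.e. fixed time `t > 0`: `c_N(t)/N → C_T(t) = D.currentCorrelation μT t`,
`c_N(t) = ∫ J · (P_t J) dμ_{N,T}`, `J = Σ_i j_i`. It is the residual of S3 `stub_fixedFrequencyMatching`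
(`stub_fixedFrequencyMatchingOfFixedTime`, dominated convergence in `t`).

The bond average `c_N(t)/N = (1/N) Σ_i Σ_k ⟨j_i(0) j_k(t)⟩_{N,T}` was reduced (part 4 of the S3 chain,
`stub_fixedTimeMatchingOfUniformLeaves`: bulk rows by window + tails, `o(N)` boundary rows by the weighted
pairing bound) to two hypotheses at the witness; this file (sorry-free) discharges them BY NAME from the two
REGISTERED anchor-uniform dynamical leaves of this item, stated so that one future proof serves this crux
and the sibling's S4 (part 1, `…FixedTimeMatchingSharedLeaves`: (C′) ⟹ (C), (B′) ⟹ (B₀) verbatim):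

* (C′) `stub_uniformAnchoredCorrelationTails` — `τ`-UNIFORM, ANCHOR-UNIFORM CORRELATION TAILS: for every
  `τ > 0`, `ε > 0` there are `R`, `N₀` with `Σ_{|k-i|>R} |⟨j_i(0) j_k(t)⟩_{N,T}| ≤ ε` for all `N ≥ N₀`, all
  `R`-deep anchors `i` and all `t ∈ [0, τ]` (light cone of the open chain at fixed time);
* (B′) `stub_uniformFixedTimeOffsetMatching` — ANCHOR-UNIFORM PER-OFFSET FIXED-TIME MATCHING under the
  hypotheses of `H_time`: for every offset `x`, `t > 0`, `ε > 0` there are `L`, `N₀` with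
  `|⟨j_i(0) j_{i+x}(t)⟩_{N,T} - ∫ j_0 · (j_x ∘ φ_t) dμT| ≤ ε` for all `N ≥ N₀` and all `L`-deep anchors `i`
  (two-dynamics coupling on bulk windows + convergence of the bulk window laws of `gibbsMeasure N T` to the
  unique regular DLR state `μT`).

* `stub_fixedTimeMatchingOfRegisteredLeaves` (registered): (C′) ⟹ [hypotheses of `H_time`] ⟹ (B′ at the
  witness) ⟹ [conclusion of `H_time`] (everywhere in `t > 0`, a fortiori a.e.);
* `fixedTimeMatching_of_registeredLeaves`: (C′) → (B′) → `H_time`, all three VERBATIM the registered texts, so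
  in the skeleton `stub_fixedTimeMatching := fixedTimeMatching_of_registeredLeaves
  stub_uniformAnchoredCorrelationTails stub_uniformFixedTimeOffsetMatching`;
* `fixedFrequencyMatching_of_registeredLeaves`: (C′) → (B′) → S3 verbatim (via part 2 of the S3 chain).

Neither leaf is in the tree: (C′) at `t = 0` is static (`⟨j_i j_k⟩_{N,T} = 0` for `|i-k| ≥ 2`, Gaussian
momenta), but for `t > 0` it is the finite-speed-of-propagation estimate for the open Langevin chain in
`L²(μ_{N,T})`, and (B′) is the comparison of the open `N`-chain kernels with the Buttà–Marchioro infinite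
dynamics on bulk windows plus one-dimensional equivalence of ensembles; both are Disproof §4 step (2).
References: Bonetto–Lebowitz–Rey-Bellet 2000 §7; Buttà–Marchioro 2016; Kundu–Dhar–Narayan 2009.
-/

noncomputable section

open MeasureTheory ProbabilityTheory Filter Topology Set Function
open scoped NNReal ENNReal

namespace Summit.AtomisticToContinuum.FouriersLaw.Theorems.AbelThermodynamicLimit.SeriesLawAtEveryLaplaceFrequency

open Literature.MathematicalPhysics.KineticTheory.HeatConduction
open Literature.MathematicalPhysics.KineticTheory OscillatorChain

/-- **Registered reduction stub `stub_fixedTimeMatchingOfRegisteredLeaves` — `H_time` from the two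
registered anchor-uniform dynamical leaves.** The anchor-uniform correlation tails (C′, the registered leaf
`stub_uniformAnchoredCorrelationTails`, closed over the parameters), the hypotheses of `H_time` (parameters
`> 0`, `T > 0` with DLR uniqueness in the regular class, a regular witness `(μT, D)`) and the anchor-uniform
per-offset fixed-time matching at this witness (the body of the registered leaf
`stub_uniformFixedTimeOffsetMatching`) imply the conclusion of `H_time`: `c_N(t)/N → C_T(t)` for a.e.
`t > 0` — in fact for every `t > 0`, by the bond average `stub_fixedTimeMatchingOfUniformLeaves` with its
tail hypothesis `hC` at `t` read off from (C′) at `τ = t`. [folklore] -/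
theorem stub_fixedTimeMatchingOfRegisteredLeaves :
    (∀ ω₂ lam β γ : ℝ, 0 < ω₂ → 0 < lam → 0 < β → 0 < γ → ∀ T : ℝ, 0 < T →
          ∀ τ : ℝ, 0 < τ → ∀ ε : ℝ, 0 < ε → ∃ R N₀ : ℕ, ∀ N : ℕ, N₀ ≤ N → ∀ i : Fin N,
            R ≤ i.val → i.val + R < N → ∀ t ∈ Set.Icc (0 : ℝ) τ,
              (∑ k : Fin N, if i.val ≤ k.val + R ∧ k.val ≤ i.val + R then (0 : ℝ) else
                |∫ z, (Literature.MathematicalPhysics.KineticTheory.HeatConduction.pinnedChain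
                        ω₂ lam β γ).bondCurrent N i z *
                    (∫ y, (Literature.MathematicalPhysics.KineticTheory.HeatConduction.pinnedChain
                        ω₂ lam β γ).bondCurrent N k y
                      ∂((Literature.MathematicalPhysics.KineticTheory.HeatConduction.pinnedChain
                        ω₂ lam β γ).transitionKernel N T T t.toNNReal z))
                  ∂((Literature.MathematicalPhysics.KineticTheory.HeatConduction.pinnedChain
                        ω₂ lam β γ).gibbsMeasure N T)|) ≤ ε) →
        ∀ ω₂ lam β γ : ℝ, 0 < ω₂ → 0 < lam → 0 < β → 0 < γ → ∀ T : ℝ, 0 < T →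
          (∀ μ₁ μ₂ : MeasureTheory.Measure
                Literature.MathematicalPhysics.KineticTheory.HeatConduction.ChainConfig,
              (Literature.MathematicalPhysics.KineticTheory.HeatConduction.pinnedChain
                    ω₂ lam β γ).IsChainGibbsMeasure T μ₁ →
              Literature.MathematicalPhysics.KineticTheory.HeatConduction.IsShiftInvariant μ₁ →
              (Literature.MathematicalPhysics.KineticTheory.HeatConduction.pinnedChain
                    ω₂ lam β γ).HasSuperstabilityEstimate μ₁ →
              (Literature.MathematicalPhysics.KineticTheory.HeatConduction.pinnedChain
                    ω₂ lam β γ).IsChainGibbsMeasure T μ₂ →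
              Literature.MathematicalPhysics.KineticTheory.HeatConduction.IsShiftInvariant μ₂ →
              (Literature.MathematicalPhysics.KineticTheory.HeatConduction.pinnedChain
                    ω₂ lam β γ).HasSuperstabilityEstimate μ₂ → μ₁ = μ₂) →
          ∀ (μT : MeasureTheory.Measure
                Literature.MathematicalPhysics.KineticTheory.HeatConduction.ChainConfig)
            (D : Literature.MathematicalPhysics.KineticTheory.HeatConduction.InfiniteChainDynamics
              (Literature.MathematicalPhysics.KineticTheory.HeatConduction.pinnedChain ω₂ lam β γ)),
            (Literature.MathematicalPhysics.KineticTheory.HeatConduction.pinnedChain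
                ω₂ lam β γ).IsChainGibbsMeasure T μT →
            Literature.MathematicalPhysics.KineticTheory.HeatConduction.IsShiftInvariant μT →
            (Literature.MathematicalPhysics.KineticTheory.HeatConduction.pinnedChain
                ω₂ lam β γ).HasSuperstabilityEstimate μT →
            D.carrier ⊆ (Literature.MathematicalPhysics.KineticTheory.HeatConduction.pinnedChain
                ω₂ lam β γ).bmGood →
            D.PreservesMeasure μT →
            (∀ t : ℝ, D.HasAbsConvergentCorrelation μT t) →
            (∀ (x : ℤ) (t : ℝ), 0 < t → ∀ ε : ℝ, 0 < ε → ∃ L N₀ : ℕ, ∀ N : ℕ, N₀ ≤ N → ∀ i k : Fin N,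
              L ≤ i.val → i.val + L < N → (k.val : ℤ) = i.val + x →
              |(∫ z, (Literature.MathematicalPhysics.KineticTheory.HeatConduction.pinnedChain
                        ω₂ lam β γ).bondCurrent N i z *
                  (∫ y, (Literature.MathematicalPhysics.KineticTheory.HeatConduction.pinnedChain
                        ω₂ lam β γ).bondCurrent N k y
                    ∂((Literature.MathematicalPhysics.KineticTheory.HeatConduction.pinnedChain
                        ω₂ lam β γ).transitionKernel N T T t.toNNReal z))
                  ∂((Literature.MathematicalPhysics.KineticTheory.HeatConduction.pinnedChain
                        ω₂ lam β γ).gibbsMeasure N T)) -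
                ∫ σ, (Literature.MathematicalPhysics.KineticTheory.HeatConduction.pinnedChain
                        ω₂ lam β γ).bondCurrentZ σ 0 *
                  (Literature.MathematicalPhysics.KineticTheory.HeatConduction.pinnedChain
                        ω₂ lam β γ).bondCurrentZ (D.flow t σ) x ∂μT| ≤ ε) →
            ∀ᵐ t ∂(MeasureTheory.volume.restrict (Set.Ioi (0:ℝ))),
              Filter.Tendsto (fun N : ℕ =>
                  (∫ z, (∑ i : Fin N, (Literature.MathematicalPhysics.KineticTheory.HeatConduction.pinnedChain
                          ω₂ lam β γ).bondCurrent N i z) *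
                      (∫ y, (∑ i : Fin N, (Literature.MathematicalPhysics.KineticTheory.HeatConduction.pinnedChain
                          ω₂ lam β γ).bondCurrent N i y)
                        ∂((Literature.MathematicalPhysics.KineticTheory.HeatConduction.pinnedChain
                          ω₂ lam β γ).transitionKernel N T T t.toNNReal z))
                    ∂((Literature.MathematicalPhysics.KineticTheory.HeatConduction.pinnedChain
                          ω₂ lam β γ).gibbsMeasure N T)) / (N : ℝ))
                Filter.atTop (nhds (D.currentCorrelation μT t)) := by
  intro hC ω₂ lam β γ hω hl hβ hγ T hT _hU μT D _hG _hS _hss _hcar _hPres hAC hB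
  refine (ae_restrict_iff' measurableSet_Ioi).2 (ae_of_all _ fun t ht => ?_)
  refine stub_fixedTimeMatchingOfUniformLeaves ω₂ lam β γ hω hl hβ hγ T hT μT D hAC hB ?_ t ht
  intro s hs ε hε
  obtain ⟨R, N₀, h⟩ := hC ω₂ lam β γ hω hl hβ hγ T hT s hs ε hε
  exact ⟨R, N₀, fun N hN i h1 h2 => h N hN i h1 h2 s ⟨hs.le, le_rfl⟩⟩

/-- **`H_time` from the two registered leaves, closed form**: (C′) `stub_uniformAnchoredCorrelationTails` →
(B′) `stub_uniformFixedTimeOffsetMatching` → `stub_fixedTimeMatching`, all three VERBATIM the registered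
texts (for the skeleton: `stub_fixedTimeMatching := fixedTimeMatching_of_registeredLeaves
stub_uniformAnchoredCorrelationTails stub_uniformFixedTimeOffsetMatching`). [folklore] -/
theorem fixedTimeMatching_of_registeredLeaves :
    (∀ ω₂ lam β γ : ℝ, 0 < ω₂ → 0 < lam → 0 < β → 0 < γ → ∀ T : ℝ, 0 < T →
      ∀ τ : ℝ, 0 < τ → ∀ ε : ℝ, 0 < ε → ∃ R N₀ : ℕ, ∀ N : ℕ, N₀ ≤ N → ∀ i : Fin N,
        R ≤ i.val → i.val + R < N → ∀ t ∈ Set.Icc (0 : ℝ) τ,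
          (∑ k : Fin N, if i.val ≤ k.val + R ∧ k.val ≤ i.val + R then (0 : ℝ) else
            |∫ z, (Literature.MathematicalPhysics.KineticTheory.HeatConduction.pinnedChain
                    ω₂ lam β γ).bondCurrent N i z *
                (∫ y, (Literature.MathematicalPhysics.KineticTheory.HeatConduction.pinnedChain
                    ω₂ lam β γ).bondCurrent N k y
                  ∂((Literature.MathematicalPhysics.KineticTheory.HeatConduction.pinnedChain
                    ω₂ lam β γ).transitionKernel N T T t.toNNReal z))
              ∂((Literature.MathematicalPhysics.KineticTheory.HeatConduction.pinnedChain
                    ω₂ lam β γ).gibbsMeasure N T)|) ≤ ε) →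
    (∀ ω₂ lam β γ : ℝ, 0 < ω₂ → 0 < lam → 0 < β → 0 < γ → ∀ T : ℝ, 0 < T →
      (∀ μ₁ μ₂ : MeasureTheory.Measure
            Literature.MathematicalPhysics.KineticTheory.HeatConduction.ChainConfig,
          (Literature.MathematicalPhysics.KineticTheory.HeatConduction.pinnedChain
                ω₂ lam β γ).IsChainGibbsMeasure T μ₁ →
          Literature.MathematicalPhysics.KineticTheory.HeatConduction.IsShiftInvariant μ₁ →
          (Literature.MathematicalPhysics.KineticTheory.HeatConduction.pinnedChain
                ω₂ lam β γ).HasSuperstabilityEstimate μ₁ →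
          (Literature.MathematicalPhysics.KineticTheory.HeatConduction.pinnedChain
                ω₂ lam β γ).IsChainGibbsMeasure T μ₂ →
          Literature.MathematicalPhysics.KineticTheory.HeatConduction.IsShiftInvariant μ₂ →
          (Literature.MathematicalPhysics.KineticTheory.HeatConduction.pinnedChain
                ω₂ lam β γ).HasSuperstabilityEstimate μ₂ → μ₁ = μ₂) →
      ∀ (μT : MeasureTheory.Measure
            Literature.MathematicalPhysics.KineticTheory.HeatConduction.ChainConfig)
        (D : Literature.MathematicalPhysics.KineticTheory.HeatConduction.InfiniteChainDynamics
          (Literature.MathematicalPhysics.KineticTheory.HeatConduction.pinnedChain ω₂ lam β γ)),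
        (Literature.MathematicalPhysics.KineticTheory.HeatConduction.pinnedChain
            ω₂ lam β γ).IsChainGibbsMeasure T μT →
        Literature.MathematicalPhysics.KineticTheory.HeatConduction.IsShiftInvariant μT →
        (Literature.MathematicalPhysics.KineticTheory.HeatConduction.pinnedChain
            ω₂ lam β γ).HasSuperstabilityEstimate μT →
        D.carrier ⊆ (Literature.MathematicalPhysics.KineticTheory.HeatConduction.pinnedChain
            ω₂ lam β γ).bmGood →
        D.PreservesMeasure μT →
        (∀ t : ℝ, D.HasAbsConvergentCorrelation μT t) →
        ∀ (x : ℤ) (t : ℝ), 0 < t → ∀ ε : ℝ, 0 < ε → ∃ L N₀ : ℕ, ∀ N : ℕ, N₀ ≤ N → ∀ i k : Fin N,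
          L ≤ i.val → i.val + L < N → (k.val : ℤ) = i.val + x →
          |(∫ z, (Literature.MathematicalPhysics.KineticTheory.HeatConduction.pinnedChain
                    ω₂ lam β γ).bondCurrent N i z *
              (∫ y, (Literature.MathematicalPhysics.KineticTheory.HeatConduction.pinnedChain
                    ω₂ lam β γ).bondCurrent N k y
                ∂((Literature.MathematicalPhysics.KineticTheory.HeatConduction.pinnedChain
                    ω₂ lam β γ).transitionKernel N T T t.toNNReal z))
              ∂((Literature.MathematicalPhysics.KineticTheory.HeatConduction.pinnedChain
                    ω₂ lam β γ).gibbsMeasure N T)) -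
            ∫ σ, (Literature.MathematicalPhysics.KineticTheory.HeatConduction.pinnedChain
                    ω₂ lam β γ).bondCurrentZ σ 0 *
              (Literature.MathematicalPhysics.KineticTheory.HeatConduction.pinnedChain
                    ω₂ lam β γ).bondCurrentZ (D.flow t σ) x ∂μT| ≤ ε) →
    ∀ ω₂ lam β γ : ℝ, 0 < ω₂ → 0 < lam → 0 < β → 0 < γ → ∀ T : ℝ, 0 < T →
      (∀ μ₁ μ₂ : MeasureTheory.Measure
            Literature.MathematicalPhysics.KineticTheory.HeatConduction.ChainConfig,
          (Literature.MathematicalPhysics.KineticTheory.HeatConduction.pinnedChain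
                ω₂ lam β γ).IsChainGibbsMeasure T μ₁ →
          Literature.MathematicalPhysics.KineticTheory.HeatConduction.IsShiftInvariant μ₁ →
          (Literature.MathematicalPhysics.KineticTheory.HeatConduction.pinnedChain
                ω₂ lam β γ).HasSuperstabilityEstimate μ₁ →
          (Literature.MathematicalPhysics.KineticTheory.HeatConduction.pinnedChain
                ω₂ lam β γ).IsChainGibbsMeasure T μ₂ →
          Literature.MathematicalPhysics.KineticTheory.HeatConduction.IsShiftInvariant μ₂ →
          (Literature.MathematicalPhysics.KineticTheory.HeatConduction.pinnedChain
                ω₂ lam β γ).HasSuperstabilityEstimate μ₂ → μ₁ = μ₂) →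
      ∀ (μT : MeasureTheory.Measure
            Literature.MathematicalPhysics.KineticTheory.HeatConduction.ChainConfig)
        (D : Literature.MathematicalPhysics.KineticTheory.HeatConduction.InfiniteChainDynamics
          (Literature.MathematicalPhysics.KineticTheory.HeatConduction.pinnedChain ω₂ lam β γ)),
        (Literature.MathematicalPhysics.KineticTheory.HeatConduction.pinnedChain
            ω₂ lam β γ).IsChainGibbsMeasure T μT →
        Literature.MathematicalPhysics.KineticTheory.HeatConduction.IsShiftInvariant μT →
        (Literature.MathematicalPhysics.KineticTheory.HeatConduction.pinnedChain
            ω₂ lam β γ).HasSuperstabilityEstimate μT →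
        D.carrier ⊆ (Literature.MathematicalPhysics.KineticTheory.HeatConduction.pinnedChain
            ω₂ lam β γ).bmGood →
        D.PreservesMeasure μT →
        (∀ t : ℝ, D.HasAbsConvergentCorrelation μT t) →
        ∀ᵐ t ∂(MeasureTheory.volume.restrict (Set.Ioi (0:ℝ))),
          Filter.Tendsto (fun N : ℕ =>
              (∫ z, (∑ i : Fin N, (Literature.MathematicalPhysics.KineticTheory.HeatConduction.pinnedChain
                      ω₂ lam β γ).bondCurrent N i z) *
                  (∫ y, (∑ i : Fin N, (Literature.MathematicalPhysics.KineticTheory.HeatConduction.pinnedChain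
                      ω₂ lam β γ).bondCurrent N i y)
                    ∂((Literature.MathematicalPhysics.KineticTheory.HeatConduction.pinnedChain
                      ω₂ lam β γ).transitionKernel N T T t.toNNReal z))
                ∂((Literature.MathematicalPhysics.KineticTheory.HeatConduction.pinnedChain
                      ω₂ lam β γ).gibbsMeasure N T)) / (N : ℝ))
            Filter.atTop (nhds (D.currentCorrelation μT t)) := by
  intro hC hB ω₂ lam β γ hω hl hβ hγ T hT hU μT D hG hS hss hcar hPres hAC
  exact stub_fixedTimeMatchingOfRegisteredLeaves hC ω₂ lam β γ hω hl hβ hγ T hT hU μT D hG hS hss hcar hPres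
    hAC (hB ω₂ lam β γ hω hl hβ hγ T hT hU μT D hG hS hss hcar hPres hAC)

/-- **S3 from the two registered leaves, closed form**: (C′) `stub_uniformAnchoredCorrelationTails` →
(B′) `stub_uniformFixedTimeOffsetMatching` → `stub_fixedFrequencyMatching`, all three VERBATIM the registered
texts (`H_time` from the leaves, then `stub_fixedFrequencyMatchingOfFixedTime`, dominated convergence in `t`).
[folklore] -/
theorem fixedFrequencyMatching_of_registeredLeaves :
    (∀ ω₂ lam β γ : ℝ, 0 < ω₂ → 0 < lam → 0 < β → 0 < γ → ∀ T : ℝ, 0 < T →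
      ∀ τ : ℝ, 0 < τ → ∀ ε : ℝ, 0 < ε → ∃ R N₀ : ℕ, ∀ N : ℕ, N₀ ≤ N → ∀ i : Fin N,
        R ≤ i.val → i.val + R < N → ∀ t ∈ Set.Icc (0 : ℝ) τ,
          (∑ k : Fin N, if i.val ≤ k.val + R ∧ k.val ≤ i.val + R then (0 : ℝ) else
            |∫ z, (Literature.MathematicalPhysics.KineticTheory.HeatConduction.pinnedChain
                    ω₂ lam β γ).bondCurrent N i z *
                (∫ y, (Literature.MathematicalPhysics.KineticTheory.HeatConduction.pinnedChain
                    ω₂ lam β γ).bondCurrent N k y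
                  ∂((Literature.MathematicalPhysics.KineticTheory.HeatConduction.pinnedChain
                    ω₂ lam β γ).transitionKernel N T T t.toNNReal z))
              ∂((Literature.MathematicalPhysics.KineticTheory.HeatConduction.pinnedChain
                    ω₂ lam β γ).gibbsMeasure N T)|) ≤ ε) →
    (∀ ω₂ lam β γ : ℝ, 0 < ω₂ → 0 < lam → 0 < β → 0 < γ → ∀ T : ℝ, 0 < T →
      (∀ μ₁ μ₂ : MeasureTheory.Measure
            Literature.MathematicalPhysics.KineticTheory.HeatConduction.ChainConfig,
          (Literature.MathematicalPhysics.KineticTheory.HeatConduction.pinnedChain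
                ω₂ lam β γ).IsChainGibbsMeasure T μ₁ →
          Literature.MathematicalPhysics.KineticTheory.HeatConduction.IsShiftInvariant μ₁ →
          (Literature.MathematicalPhysics.KineticTheory.HeatConduction.pinnedChain
                ω₂ lam β γ).HasSuperstabilityEstimate μ₁ →
          (Literature.MathematicalPhysics.KineticTheory.HeatConduction.pinnedChain
                ω₂ lam β γ).IsChainGibbsMeasure T μ₂ →
          Literature.MathematicalPhysics.KineticTheory.HeatConduction.IsShiftInvariant μ₂ →
          (Literature.MathematicalPhysics.KineticTheory.HeatConduction.pinnedChain
                ω₂ lam β γ).HasSuperstabilityEstimate μ₂ → μ₁ = μ₂) →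
      ∀ (μT : MeasureTheory.Measure
            Literature.MathematicalPhysics.KineticTheory.HeatConduction.ChainConfig)
        (D : Literature.MathematicalPhysics.KineticTheory.HeatConduction.InfiniteChainDynamics
          (Literature.MathematicalPhysics.KineticTheory.HeatConduction.pinnedChain ω₂ lam β γ)),
        (Literature.MathematicalPhysics.KineticTheory.HeatConduction.pinnedChain
            ω₂ lam β γ).IsChainGibbsMeasure T μT →
        Literature.MathematicalPhysics.KineticTheory.HeatConduction.IsShiftInvariant μT →
        (Literature.MathematicalPhysics.KineticTheory.HeatConduction.pinnedChain
            ω₂ lam β γ).HasSuperstabilityEstimate μT →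
        D.carrier ⊆ (Literature.MathematicalPhysics.KineticTheory.HeatConduction.pinnedChain
            ω₂ lam β γ).bmGood →
        D.PreservesMeasure μT →
        (∀ t : ℝ, D.HasAbsConvergentCorrelation μT t) →
        ∀ (x : ℤ) (t : ℝ), 0 < t → ∀ ε : ℝ, 0 < ε → ∃ L N₀ : ℕ, ∀ N : ℕ, N₀ ≤ N → ∀ i k : Fin N,
          L ≤ i.val → i.val + L < N → (k.val : ℤ) = i.val + x →
          |(∫ z, (Literature.MathematicalPhysics.KineticTheory.HeatConduction.pinnedChain
                    ω₂ lam β γ).bondCurrent N i z *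
              (∫ y, (Literature.MathematicalPhysics.KineticTheory.HeatConduction.pinnedChain
                    ω₂ lam β γ).bondCurrent N k y
                ∂((Literature.MathematicalPhysics.KineticTheory.HeatConduction.pinnedChain
                    ω₂ lam β γ).transitionKernel N T T t.toNNReal z))
              ∂((Literature.MathematicalPhysics.KineticTheory.HeatConduction.pinnedChain
                    ω₂ lam β γ).gibbsMeasure N T)) -
            ∫ σ, (Literature.MathematicalPhysics.KineticTheory.HeatConduction.pinnedChain
                    ω₂ lam β γ).bondCurrentZ σ 0 *
              (Literature.MathematicalPhysics.KineticTheory.HeatConduction.pinnedChain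
                    ω₂ lam β γ).bondCurrentZ (D.flow t σ) x ∂μT| ≤ ε) →
    ∀ ω₂ lam β γ : ℝ, 0 < ω₂ → 0 < lam → 0 < β → 0 < γ → ∀ T : ℝ, 0 < T →
      (∀ μ₁ μ₂ : MeasureTheory.Measure
            Literature.MathematicalPhysics.KineticTheory.HeatConduction.ChainConfig,
          (Literature.MathematicalPhysics.KineticTheory.HeatConduction.pinnedChain
                ω₂ lam β γ).IsChainGibbsMeasure T μ₁ →
          Literature.MathematicalPhysics.KineticTheory.HeatConduction.IsShiftInvariant μ₁ →
          (Literature.MathematicalPhysics.KineticTheory.HeatConduction.pinnedChain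
                ω₂ lam β γ).HasSuperstabilityEstimate μ₁ →
          (Literature.MathematicalPhysics.KineticTheory.HeatConduction.pinnedChain
                ω₂ lam β γ).IsChainGibbsMeasure T μ₂ →
          Literature.MathematicalPhysics.KineticTheory.HeatConduction.IsShiftInvariant μ₂ →
          (Literature.MathematicalPhysics.KineticTheory.HeatConduction.pinnedChain
                ω₂ lam β γ).HasSuperstabilityEstimate μ₂ → μ₁ = μ₂) →
      ∀ (μT : MeasureTheory.Measure
            Literature.MathematicalPhysics.KineticTheory.HeatConduction.ChainConfig)
        (D : Literature.MathematicalPhysics.KineticTheory.HeatConduction.InfiniteChainDynamics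
          (Literature.MathematicalPhysics.KineticTheory.HeatConduction.pinnedChain ω₂ lam β γ)),
        (Literature.MathematicalPhysics.KineticTheory.HeatConduction.pinnedChain
            ω₂ lam β γ).IsChainGibbsMeasure T μT →
        Literature.MathematicalPhysics.KineticTheory.HeatConduction.IsShiftInvariant μT →
        (Literature.MathematicalPhysics.KineticTheory.HeatConduction.pinnedChain
            ω₂ lam β γ).HasSuperstabilityEstimate μT →
        D.carrier ⊆ (Literature.MathematicalPhysics.KineticTheory.HeatConduction.pinnedChain
            ω₂ lam β γ).bmGood →
        D.PreservesMeasure μT →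
        (∀ t : ℝ, D.HasAbsConvergentCorrelation μT t) →
        ∀ ν : ℝ, 0 < ν →
          Filter.Tendsto (fun N : ℕ =>
              MeasureTheory.integral (MeasureTheory.volume.restrict (Set.Ioi (0:ℝ))) (fun t : ℝ =>
                Real.exp (-(ν * t)) *
                  ∫ z, (∑ i : Fin N, (Literature.MathematicalPhysics.KineticTheory.HeatConduction.pinnedChain
                          ω₂ lam β γ).bondCurrent N i z) *
                    (∫ y, (∑ i : Fin N, (Literature.MathematicalPhysics.KineticTheory.HeatConduction.pinnedChain
                          ω₂ lam β γ).bondCurrent N i y)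
                      ∂((Literature.MathematicalPhysics.KineticTheory.HeatConduction.pinnedChain
                          ω₂ lam β γ).transitionKernel N T T t.toNNReal z))
                    ∂((Literature.MathematicalPhysics.KineticTheory.HeatConduction.pinnedChain
                          ω₂ lam β γ).gibbsMeasure N T)) / (N : ℝ))
            Filter.atTop
            (nhds (MeasureTheory.integral (MeasureTheory.volume.restrict (Set.Ioi (0:ℝ)))
              (fun t : ℝ => Real.exp (-(ν * t)) * D.currentCorrelation μT t))) := by
  intro hC hB ω₂ lam β γ hω hl hβ hγ T hT hU μT D hG hS hss hcar hPres hAC ν hν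
  exact stub_fixedFrequencyMatchingOfFixedTime ω₂ lam β γ hω hl hβ hγ T hT hU μT D hG hS hss hcar hPres hAC
    (fixedTimeMatching_of_registeredLeaves hC hB ω₂ lam β γ hω hl hβ hγ T hT hU μT D hG hS hss hcar hPres
      hAC) ν hν

end Summit.AtomisticToContinuum.FouriersLaw.Theorems.AbelThermodynamicLimit.SeriesLawAtEveryLaplaceFrequency

end
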